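import Literature.MathematicalPhysics.QuantumFieldTheory.Balaban1983to89.B9B8KnitTorusSocketCatalogued
import Literature.MathematicalPhysics.QuantumFieldTheory.Balaban1983to89.B9Thm311PositivityKnitLetter
import Literature.MathematicalPhysics.QuantumFieldTheory.Balaban1983to89.B9B8KnitLetterProjectionC
import Literature.MathematicalPhysics.QuantumFieldTheory.Balaban1983to89.B8Thm2TorusLettersAllPerOfKnit

/-!
# `Balaban1983to89.B9B8KnitTorusSocketCataloguedFour` — T. Bałaban, *Propagators and renormalization transformations for lattice gauge theories. I*,
# Commun. Math. Phys. **95** (1984) 17–40 [Balaban1985RegularSpaces], Thm 2 p. 83, (1.58)–(1.60) pp. 86–87, Prop. 3 p. 87, p. 77 («Ω_j = T_η»); *… II*,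
# CMP **96** (1984) 223–250 [Balaban1984PropagatorsII], (2.1)–(2.4) p. 224, (2.16) p. 225; *Propagators for lattice gauge theories in a background field*,
# CMP **99** (1985) 389–434 [Balaban1985BackgroundPropagators], (3.16) p. 393, (3.24)–(3.25) pp. 394–395, (3.41) p. 397, Thm 3.3 p. 399, (3.69) p. 404,
# p. 408 l. 30–34 («In [4] we have proved all theorems under the assumption that R, M are sufficiently large. We take these numbers as powers of L»),
# Thm 3.11 p. 416 («This is obvious for the first three operators»); *Averaging operations for lattice gauge theories*, CMP **98** (1985) 17–51
# [Balaban1985Averaging], Prop. 2 p. 26, (52)–(54) pp. 26–27: **THE (B)-ARROW HYPOTHESIS WITH FOUR Δ_a-SIDE MEMBERS AT BIG BLOCKS `M = L^a`** — file F10′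
# (over F10 `B9B8KnitTorusSocketCatalogued`).

statement-level skeleton of published theorems with citation tags; proofs where landed; nothing here is a claim about the Yang–Mills mass gap

THE POINT.  F10 `sockB9P3Per_torus_allLevels_catalogued` displays the SIX Δ_a-side members (1)–(6) of file 8c's binder at EVERY shape-member
`i : KIdx d ℓ hd hL 1 1` of a level `1 ≤ m′ ≤ K′` — whatever its big-block parameter `i.Mh`.  Two of the six are theorems of the tree with no smallness
beyond the `U(N)`-valuedness of the background and of the knit legs — print's «obvious for the first three operators» of Thm 3.11 p. 416:
(5) `IsUnit Δ′_a(U)` = `B9Thm311PositivityKnitLetter.isUnit_deltaPrimeAY_parKnitY` and (6) `IsUnit (Q′G′²Q′*)(U)` =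
`B9B8KnitLetterProjectionC.isUnit_XY_parKnitY`, the legs being `U(N)`-valued on the admissible backgrounds by [B7] Prop. 2
(`B8Thm2TorusLettersAllPerOfKnit.parKnitY_mem_of_inAk`).  And the remaining four — `IsUnit Δ_a(U)` and the three weighted bounds of `G = Δ_a⁻¹` at a
uniform `B₀`, [B9] (3.69) p. 404 ∕ Thm 3.3-type content — are printed «for M sufficiently large», `M` a power of `L` (p. 408 l. 30–34, Thm 3.11 p. 416): a
supplier serves them at members whose big blocks are large, so the binder must NAME the big-block parameter.  THIS FILE re-issues F10 with
(a) members (5)(6) DISCHARGED and (b) the clause `i.Mh = L^a` in the binder, `a` being the exponent the caller already chooses for the catalogue's volume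
slack `K′ + a + 3 ≤ m + K` (`L^a ≥ 8`) — the catalogue `B8Thm2TorusMemberWeighted.exists_constLev_member_weight` delivers exactly such members.  Callers who
need `M ≥ M₁` take `a` with `L^a ≥ M₁`.

WHAT THIS FILE PROVES (one `theorem`; 0 `def`, 0 new named facts, 0 `sorry`; standard axioms; fibre `M_N(ℂ)`, `τ = tr`): ★★★
`sockB9P3Per_torus_allLevels_catalogued_four` — F10's conclusion VERBATIM (same constants `B*`, `C*`, `c_P`), from the FOUR Δ_a-side members (1)–(4) displayed
at the shape-members with `i.Mh = L^a` only.

HONEST FRAMING.  Proof = F10's proof re-run (F9 `sockB9P3Per_torus_allLevels_of_deltaASide` + the catalogue BY NAME), the catalogue's clause `i.Mh = L^a`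
now kept, and (5)(6) supplied by the two Thm-3.11 theorems at `G = U(N)`; the FOUR members (1)–(4) REMAIN DISPLAYED (member-generic at `M_h = L^a`), as do
the windows on `a_T` and F7's numeric condition; nothing of F10, A17, the catalogue, pub-ymgap or the lane is modified; `stub_PV3A` NOT discharged; counts
unmoved; one finite 𝕋⁴ programme at fixed ε, Bałaban AS PRINTED; the YM mass gap (Clay) is NOT proved by any of this — nothing continuum ∕ ℝ⁴ ∕ OS.
Cell `lit-balaban`, seat t2s-1 g9 («B8 §3 Thm 2 TORUS SUPPLIER»); `--supports stmt-QuantumFields-19200`.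

References: T. Bałaban, CMP 95 (1984) 17–40 [Balaban1985RegularSpaces] Thm 2 p.83, p.77, (1.58)–(1.60) pp.86–87, Prop. 3 p.87; CMP 96 (1984) 223–250
[Balaban1984PropagatorsII] (2.1)–(2.4) p.224, (2.16) p.225; CMP 99 (1985) 389–434 [Balaban1985BackgroundPropagators] (3.16) p.393, (3.24)–(3.25) pp.394–395,
(3.41) p.397, Thm 3.3 p.399, (3.69) p.404, p.408, Thm 3.11 p.416; CMP 98 (1985) 17–51 [Balaban1985Averaging] Prop. 2 p.26, (52)–(54) pp.26–27.
-/

noncomputable section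

namespace Literature.MathematicalPhysics.QuantumFieldTheory.Balaban1983to89.B9B8KnitTorusSocketCataloguedFour

open scoped BigOperators
open Node00
open B7Prop1Explicit renaming Site → LSite
open B7Prop1Explicit (e)
open B7Prop2Explicit (unitaryUnits C0 c2' C0_pos avgClosed_unitaryUnits)
open B6KLevelCensusIndexV1 (KIdx)
open B6GlobalChartV1 (PV)
open B8Ineq132 (InAk)
open B8LeafModelZd (ZdIdx)
open B8LeafModelZd3SockPer (SockB9P3Per)
open B8Thm4TorusAt (torusLam)
open B8Thm2TorusMember (torusLamb)
open B9B8AveragingJunction (parKnitY)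
open B8Thm2TorusLettersPerOfKnit (bgY bgY_mem)
open B8Thm2TorusLettersAllPerOfKnit (parKnitY_mem_of_inAk)
open B12Ineq417Flat (shiftCfg)
open B9SupplySockB9P3ZdLetters (OpsZd)
open B9Eq316AveragingTransposeZd (qQ betaTau alphaQ)
open B9B8KnitTorusSocketAllLevels (sockB9P3Per_torus_allLevels_of_deltaASide)
open B8Thm2TorusMemberWeighted (exists_constLev_member_weight)
open B9B8KnitLandauProjection (shiftCfg_eq_of_isPeriodic)
open B9Thm311PositivityKnitLetter (isUnit_deltaPrimeAY_parKnitY)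
open B9B8KnitLetterProjectionC (isUnit_XY_parKnitY)
open T4TermwiseTorus (IsPeriodic)

variable {d ℓ : ℕ} {hd : 1 ≤ d + 1} {hL : Odd (ℓ + 1) ∧ 1 < ℓ + 1}

section Matrix

open scoped Matrix Matrix.Norms.L2Operator

variable {N : ℕ} [NeZero N]

/-- ★★★ **THE [B8] THM 2 TORUS ASSEMBLER's (B)-ARROW HYPOTHESIS FROM FOUR Δ_a-SIDE MEMBERS AT BIG BLOCKS `M = L^a`.**  For the torus `PV d ℓ m K`
(period `P₀ = 2L^{m+K}`), a truncation bound `K′` with the catalogue's volume slack `K′ + a + 3 ≤ m + K` (`L^a ≥ 8`), a threshold `a_T` in the windows and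
F7's member-uniform numeric condition: IF the FOUR Δ_a-side members — `Δ_a(U)` invertible and the three weighted bounds of `G = Δ_a⁻¹(U)` at a uniform
`B₀` — hold at EVERY k-level member `i` (band `b₀ = b₁ = 1`) of the shape of record at a level `1 ≤ m′ ≤ K′` WITH BIG BLOCKS `i.Mh = L^a` (`i.k = m′ + 1`,
constant level `m′`, `c_f = L^{m′+1}`, the weights of record, period `P₀`) and every admissible background `U₀ ∈ 𝔄_{m′}(T, α₀)`, `α₀ ≤ a_T`, `U(N)`-valued and
`P₀`-periodic, THEN the socket holds at EVERY truncation `m′ ≤ K′` at F9's constant set.  Members (5) `IsUnit Δ′_a(U)` and (6) `IsUnit (Q′G′²Q′*)(U)` of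
F10's binder are theorems here (Thm 3.11 p. 416: «obvious for the first three operators»), the knit legs being `U(N)`-valued by [B7] Prop. 2.
[cite: Balaban1985RegularSpaces, Thm 2 p.83, (1.58)–(1.60) pp.86–87, Prop. 3 p.87, p.77 («Ω_j = T_η»); Balaban1984PropagatorsII, (2.1)–(2.4) p.224, (2.16) p.225; Balaban1985BackgroundPropagators, Thm 3.3 p.399, (3.16) p.393, (3.24)–(3.25) pp.394–395, (3.41) p.397, (3.69) p.404, p.408 l.30–34, Thm 3.11 p.416; Balaban1985Averaging, Prop. 2 p.26, (52)–(54) pp.26–27] -/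
theorem sockB9P3Per_torus_allLevels_catalogued_four (hℓ : 4 ≤ ℓ) (hd2 : 2 ≤ d + 1) (hL1 : 1 ≤ ℓ + 1)
    (τ : Matrix (Fin N) (Fin N) ℂ →ₗ[ℂ] ℂ) (hτ : ∀ a, τ a = Matrix.trace a) (hτt : ∀ a b, τ (a * b) = τ (b * a))
    {Cτ : ℝ} (hCτ : ∀ x y : Matrix (Fin N) (Fin N) ℂ, |(τ (star x * y)).re| ≤ Cτ * ‖x‖ * ‖y‖)
    {m K K' a : ℕ} (h8 : 8 ≤ (ℓ + 1) ^ a) (hK : K' + a + 3 ≤ m + K) {η : ℝ} (hη : 0 < η) {k : ℕ} (hk : 1 ≤ k)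
    (ops₀ : ℝ → ZdIdx (d + 1) (ℓ + 1) → ℕ →
      (letI : CStarAlgebra (Matrix (Fin N) (Fin N) ℂ) := {}; OpsZd (d + 1) (Matrix (Fin N) (Fin N) ℂ)))
    {M : ℝ} (hM1 : 1 ≤ M) {B₀ aT : ℝ} (hB₀ : 0 < B₀) (haT : 0 < aT) (haTQ : aT ≤ alphaQ (d + 1) (ℓ + 1) / ((ℓ + 1 : ℕ) : ℝ) ^ 2)
    (haT3 : C0 (d + 1) * aT ≤ 1 / 3) (haT2 : 2 * aT ≤ c2' (d + 1) (ℓ + 1))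
    (hεB : 2 * ((48 * ((d : ℝ) + 1) + 14 * d * M + (32 * ((d : ℝ) + 2) ^ 2 +
        12 * ((d : ℝ) + 1) ^ 2 * (13344 * ((d : ℝ) + 1) * ((d : ℝ) + 2) ^ 2 * ((d : ℝ) + 5) * (((ℓ + 1 : ℕ) : ℝ)) ^ (d + 4)) *
          (Cτ * (letI : CStarAlgebra (Matrix (Fin N) (Fin N) ℂ) := {}; betaTau τ)))) * aT) * B₀ ≤ 1)
    (hΔ : letI : CStarAlgebra (Matrix (Fin N) (Fin N) ℂ) := {}
      ∀ (i : KIdx d ℓ hd hL 1 1) (m' : ℕ), 1 ≤ m' → m' ≤ K' → i.k = m' + 1 → (∀ x, i.D.lev x = m') → i.Mh = (ℓ + 1) ^ a →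
      i.cf = (((ℓ + 1 : ℕ) : ℝ)) ^ (m' + 1) →
      (∀ ι : IBondY i, i.w ι = i.cf ^ 2 * (((((ℓ + 1 : ℕ) : ℝ)) ^ (ι.1.1 : ℕ)) ^ (d + 1) * (1 / (((ℓ + 1 : ℕ) : ℝ)) ^ (ι.1.1 : ℕ)) ^ 2)) →
      (PV d ℓ i.m i.K hd hL).sitesPerDir 0 = (PV d ℓ m K hd hL).sitesPerDir 0 →
      ∀ (α₀ : ℝ) (U₀ : LSite (d + 1) → Fin (d + 1) → (Matrix (Fin N) (Fin N) ℂ)ˣ),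
      (∀ x κ, U₀ x κ ∈ B7Prop2Explicit.unitaryUnits (Matrix (Fin N) (Fin N) ℂ)) →
      IsPeriodic ((PV d ℓ m K hd hL).sitesPerDir 0) U₀ → 0 < α₀ → α₀ ≤ aT →
      InAk (ℓ + 1) m' η α₀ (fun _ => (Set.univ : Set (LSite (d + 1)))) U₀ →
        IsUnit (deltaAY i (parKnitY i) (parBY i) (GpY i (parKnitY i)) (bgY i U₀)) ∧
        (∀ F, wNormBY i (-1) (GAY i (parKnitY i) (parBY i) (GpY i (parKnitY i)) (bgY i U₀) F) ≤ B₀ * wNormBY i (-3) F) ∧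
        (∀ F ν, wNormBY i (-2) (cdB i (bgY i U₀) ν (GAY i (parKnitY i) (parBY i) (GpY i (parKnitY i)) (bgY i U₀) F)) ≤ B₀ * wNormBY i (-3) F) ∧
        (∀ F, wNormBY i (-3) (lapB i (bgY i U₀) (GAY i (parKnitY i) (parBY i) (GpY i (parKnitY i)) (bgY i U₀) F)) ≤ B₀ * wNormBY i (-3) F))
    (len : LSite (d + 1) → ℝ) :
    letI : CStarAlgebra (Matrix (Fin N) (Fin N) ℂ) := {}
    ∀ m', m' ≤ K' →
      SockB9P3Per (𝔸 := Matrix (Fin N) (Fin N) ℂ) ((PV d ℓ m K hd hL).sitesPerDir 0) (ℓ + 1)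
        (max (max 1 (2 * (2 * B₀) * max 1 (qQ (d + 1) (ℓ + 1) Cτ (betaTau τ) 0))) (max 2 (4 * ((d + 1 : ℕ) : ℝ))))
        (max (2 * max 0 (2 * (2 * B₀)) * max 1 (qQ (d + 1) (ℓ + 1) Cτ (betaTau τ) 0)) 4)
        (min (1 / 16) (min aT (min aT (1 / (2 * (2 * B₀) * (14 * ((d + 1 - 1 : ℕ) : ℝ)) * M + 1)))))
        0 len η m' (fun _ => (Set.univ : Set (LSite (d + 1)))) (fun m'' => torusLam (d := d + 1) m'') (fun m'' => torusLamb (d := d + 1) m'') := by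
  classical
  letI : CStarAlgebra (Matrix (Fin N) (Fin N) ℂ) := {}
  -- the period of the torus, as a number
  have hP₀ : (PV d ℓ m K hd hL).sitesPerDir 0 = 2 * (ℓ + 1) ^ (m + K) := by
    show 2 * (ℓ + 1) ^ (m + K - 0) = _; rw [Nat.sub_zero]
  -- the member family: t2s-1 g7's weighted constant-level catalogue at `b₀ = b₁ = 1`, its big-block clause `M_h = L^a` KEPT
  have hall : ∀ m' : ℕ, ∃ i : KIdx d ℓ hd hL 1 1, 1 ≤ m' → m' ≤ K' →
      ((∀ x, i.D.lev x = m') ∧ i.k = m' + 1 ∧ (∀ z : SiteY i, levY i z = m') ∧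
      (∀ ι : IBondY i, i.w ι = i.cf ^ 2 * (((((ℓ + 1 : ℕ) : ℝ)) ^ (ι.1.1 : ℕ)) ^ (d + 1) * (1 / (((ℓ + 1 : ℕ) : ℝ)) ^ (ι.1.1 : ℕ)) ^ 2)) ∧
      i.cf = (((ℓ + 1 : ℕ) : ℝ)) ^ (m' + 1) ∧ (PV d ℓ i.m i.K hd hL).sitesPerDir 0 = (PV d ℓ m K hd hL).sitesPerDir 0) ∧
      i.Mh = (ℓ + 1) ^ a := by
    intro m'
    by_cases h : 1 ≤ m' ∧ m' ≤ K'
    · obtain ⟨i, him, hiK, hik, hiMh, hicf, hiD, -, hiw⟩ :=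
        exists_constLev_member_weight (d := d) (hd := hd) (hL := hL) (b₀ := (1 : ℝ)) (b₁ := (1 : ℝ)) hℓ one_pos le_rfl
          (T := m + K) (n := m') (a := a) (s := m + K - (m' + a + 2)) h.1 h8 (by omega) (by omega)
      refine ⟨i, fun _ _ => ⟨⟨hiD, hik, fun z => hiD z.1, fun ι => by rw [hiw, one_mul], by rw [hicf, hik], ?_⟩, hiMh⟩⟩
      rw [hP₀]
      show 2 * (ℓ + 1) ^ (i.m + i.K - 0) = _
      simp only [him, hiK, Nat.sub_zero, Nat.add_zero]
    · obtain ⟨i, -⟩ :=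
        exists_constLev_member_weight (d := d) (hd := hd) (hL := hL) (b₀ := (1 : ℝ)) (b₁ := (1 : ℝ)) hℓ one_pos le_rfl
          (T := 1 + 1 + a + 1 + 1) (n := 1) (a := a) (s := 1) le_rfl h8 le_rfl rfl
      exact ⟨i, fun h1 h2 => (h ⟨h1, h2⟩).elim⟩
  choose mem hmem' using hall
  have hmem : ∀ m' : ℕ, 1 ≤ m' → m' ≤ K' →
      (∀ x, (mem m').D.lev x = m') ∧ (mem m').k = m' + 1 ∧ (∀ z : SiteY (mem m'), levY (mem m') z = m') ∧
      (∀ ι : IBondY (mem m'), (mem m').w ι = (mem m').cf ^ 2 *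
        (((((ℓ + 1 : ℕ) : ℝ)) ^ (ι.1.1 : ℕ)) ^ (d + 1) * (1 / (((ℓ + 1 : ℕ) : ℝ)) ^ (ι.1.1 : ℕ)) ^ 2)) ∧
      (mem m').cf = (((ℓ + 1 : ℕ) : ℝ)) ^ (m' + 1) ∧
      (PV d ℓ (mem m').m (mem m').K hd hL).sitesPerDir 0 = (PV d ℓ m K hd hL).sitesPerDir 0 :=
    fun m' h1 h2 => (hmem' m' h1 h2).1
  have hMh : ∀ m' : ℕ, 1 ≤ m' → m' ≤ K' → (mem m').Mh = (ℓ + 1) ^ a := fun m' h1 h2 => (hmem' m' h1 h2).2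
  have hdvd : (ℓ + 1) ^ K' ∣ (PV d ℓ m K hd hL).sitesPerDir 0 := by
    rw [hP₀]; exact Dvd.dvd.mul_left (Nat.pow_dvd_pow _ (by omega)) 2
  refine sockB9P3Per_torus_allLevels_of_deltaASide hd2 hL1 τ hτ hτt hCτ hdvd hη hk mem hmem ops₀ hM1 hB₀ haT haTQ haT3 haT2 hεB
    (fun m' h1 h2 α₀ U₀ hU₀ hper hα₀ hα₀T hAk => ?_) len
  -- the four displayed members at the catalogue's member (big blocks `L^a`)
  obtain ⟨hΔ1, hΔ2, hΔ3, hΔ4⟩ := hΔ (mem m') m' h1 h2 (hmem m' h1 h2).2.1 (hmem m' h1 h2).1 (hMh m' h1 h2) (hmem m' h1 h2).2.2.2.2.1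
    (hmem m' h1 h2).2.2.2.1 (hmem m' h1 h2).2.2.2.2.2 α₀ U₀ hU₀ hper hα₀ hα₀T hAk
  -- members (5)(6): Thm 3.11's «obvious» units at `G = U(N)`, the knit legs being `U(N)`-valued on `𝔄_{m′}(T, α₀)` by [B7] Prop. 2
  have hU : ∀ μ x, bgY (mem m') U₀ μ x ∈ unitaryUnits (Matrix (Fin N) (Fin N) ℂ) := bgY_mem (mem m') hU₀
  have hU₀per : ∀ μ : Fin (d + 1), shiftCfg ((((PV d ℓ (mem m').m (mem m').K hd hL).sitesPerDir 0 : ℕ) : ℤ) • e μ) U₀ = U₀ := by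
    rw [(hmem m' h1 h2).2.2.2.2.2]; exact fun μ => shiftCfg_eq_of_isPeriodic hper μ
  have hα3 : C0 (d + 1) * α₀ ≤ 1 / 3 := (mul_le_mul_of_nonneg_left hα₀T (C0_pos (d + 1)).le).trans haT3
  have hα2 : 2 * α₀ ≤ c2' (d + 1) (ℓ + 1) := by linarith
  have hpar : ∀ z w : SiteY (mem m'), parKnitY (mem m') (bgY (mem m') U₀) z w ∈ unitaryUnits (Matrix (Fin N) (Fin N) ℂ) :=
    parKnitY_mem_of_inAk (mem m') (hmem m' h1 h2).2.2.1 h1 (avgClosed_unitaryUnits (d + 1) (ℓ + 1)) hU₀ hU₀per hα₀ hα3 hα2 hAk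
  exact ⟨hΔ1, hΔ2, hΔ3, hΔ4, isUnit_deltaPrimeAY_parKnitY (mem m') le_rfl hU hpar, isUnit_XY_parKnitY (mem m') le_rfl hU hpar⟩

end Matrix

end Literature.MathematicalPhysics.QuantumFieldTheory.Balaban1983to89.B9B8KnitTorusSocketCataloguedFour
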